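import Literature.MathematicalPhysics.KineticTheory.CellChainLangevin
import Literature.MathematicalPhysics.KineticTheory.SiteChainLaSalleUniqueness
import Literature.MathematicalPhysics.KineticTheory.LangevinChainScaleCloseness
import HarnessLib

/-!
# CEHR §5.1 scaling for the CELL BLOCK of the prefix cell chain (mixed rung): the limit chain, the region, the perturbation

Trunk T-KINETIC (Literature/MathematicalPhysics/KineticTheory). The prefix rung
`cellChain ω₂ lam β γ (· < k)` with `0 < k < N` (quartic pinning `lam q⁴/4` and FPU-`β` bonds on the
cells `i < k` of the `ω₂`-pinned, unit-coupling harmonic host; Bonetto–Lebowitz–Rey-Bellet 2000 §3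
eq. (8), §10 item 1) has interaction degree 4 on the bonds `i < k` and 2 on the bonds `i ≥ k`, outside
the common-degree Condition C3/C5 of Cuneo–Eckmann–Hairer–Rey-Bellet 2018 (Rem. 2.11). In CEHR's
high-energy scaling `q̃ = q/K`, `p̃ = p/K²`, `σ = Kt` ((5.7), energy `K⁴`) the CELL BLOCK `[0, k]`
nevertheless has a regular limit: the frictionless, bath-less `(k+1)`-site chain with pinning
`lam q⁴/4` on the sites `< k`, NO pinning on the interface site `k`, and quartic bonds `β r⁴/4` — all
degree-2 terms vanish at scale `K⁴`, and the harmonic host `(k, N)` acts on the cell block only through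
the harmonic bond `k`, at size `O(1/K)`. This file sets up the objects of that statement:

* `prefixRungProj k N h` — the projection of phase space onto the cell block `[0, k]` (a continuous
  linear map of norm `≤ 1`).
* the limit chain, written as the structure literal
  `{ U := fun i q => (if i < k then lam else 0) * q ^ 4 / 4, V := fun _ r => β * r ^ 4 / 4, γ := 0 }`:
  its derivatives, sitewise force `prefixLimit_dPotential_eq`, drift `prefixLimit_langevinDrift_eq`,
  energy bounds, and `lipschitzOnWith_prefixLimit_drift` on the region
  `prefixRungRegion k Cp Cq = {|p̃ᵢ| ≤ Cp, |q̃ᵢ| ≤ Cq}`.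

The perturbation estimate (CEHR (5.12) with the extra host-bond term) is the sequel
`PrefixRungPerturbation.lean`; the path-level closeness is `PrefixRungScaleCloseness.lean`.

## References

* N. Cuneo, J.-P. Eckmann, M. Hairer, L. Rey-Bellet, EJP 23 (2018) no. 55 (arXiv:1712.09413), §5.1
  eqs. (5.7)–(5.12), Remark 2.11.
* F. Bonetto, J. L. Lebowitz, L. Rey-Bellet, in *Mathematical Physics 2000*, §3 eq. (8).
-/

noncomputable section

open MeasureTheory Filter Topology Set Metric Function
open scoped NNReal

namespace Literature.MathematicalPhysics.KineticTheory.HeatConduction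

open OscillatorChain

/-! ### The cell-block projection -/

section Proj

variable (k N : ℕ) (h : k + 1 ≤ N)

/-- The **projection onto the cell block** `[0, k]`: `(q, p) ↦ ((q_i)_{i ≤ k}, (p_i)_{i ≤ k})`, a
continuous linear map `PhaseSpace N → PhaseSpace (k+1)` (`k + 1 ≤ N`). [folklore] -/
def prefixRungProj : PhaseSpace N →L[ℝ] PhaseSpace (k + 1) :=
  (ContinuousLinearMap.pi fun i : Fin (k + 1) =>
      (ContinuousLinearMap.proj (Fin.castLE h i)).comp
        (ContinuousLinearMap.fst ℝ (Fin N → ℝ) (Fin N → ℝ))).prod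
    (ContinuousLinearMap.pi fun i : Fin (k + 1) =>
      (ContinuousLinearMap.proj (Fin.castLE h i)).comp
        (ContinuousLinearMap.snd ℝ (Fin N → ℝ) (Fin N → ℝ)))

/-- Position components of the projection. [folklore] -/
@[simp] theorem prefixRungProj_fst (z : PhaseSpace N) (i : Fin (k + 1)) :
    (prefixRungProj k N h z).1 i = z.1 (Fin.castLE h i) := rfl

/-- Momentum components of the projection. [folklore] -/
@[simp] theorem prefixRungProj_snd (z : PhaseSpace N) (i : Fin (k + 1)) :
    (prefixRungProj k N h z).2 i = z.2 (Fin.castLE h i) := rfl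

/-- The projection does not increase the sup norm. [folklore] -/
theorem norm_prefixRungProj_le (z : PhaseSpace N) : ‖prefixRungProj k N h z‖ ≤ ‖z‖ := by
  refine (Prod.norm_def _).le.trans (max_le ?_ ?_)
  · refine (pi_norm_le_iff_of_nonneg (norm_nonneg _)).2 fun i => ?_
    rw [prefixRungProj_fst]
    exact (norm_le_pi_norm z.1 _).trans (norm_fst_le z)
  · refine (pi_norm_le_iff_of_nonneg (norm_nonneg _)).2 fun i => ?_
    rw [prefixRungProj_snd]
    exact (norm_le_pi_norm z.2 _).trans (norm_snd_le z)

end Proj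

/-! ### The limit cell chain: `U_i = [i<k] lam q⁴/4`, `V_i = β r⁴/4`, `γ = 0` -/

section Limit

/- The limit cell chain of the prefix rung, as a structure literal (no definition is introduced:
this notation expands to `{ U := fun i q => (if i < k then lam else 0) * q ^ 4 / 4,
V := fun _ r => β * r ^ 4 / 4, γ := 0 }`). -/
set_option quotPrecheck false in
local notation "P₀⟦" lam ", " β ", " k "⟧" =>
  (SiteChain.mk (fun i q => (if i < k then lam else 0) * q ^ 4 / 4) (fun _ r => β * r ^ 4 / 4) 0)

variable (lam β : ℝ) (k : ℕ)

/-- The pinning of the limit cell chain is `C^∞`. [folklore] -/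
theorem prefixLimit_contDiff_U (i : ℕ) {n : WithTop ℕ∞} :
    ContDiff ℝ n (P₀⟦lam, β, k⟧.U i) := by
  show ContDiff ℝ n fun q : ℝ => (if i < k then lam else 0) * q ^ 4 / 4
  fun_prop

/-- The bonds of the limit cell chain are `C^∞`. [folklore] -/
theorem prefixLimit_contDiff_V (i : ℕ) {n : WithTop ℕ∞} :
    ContDiff ℝ n (P₀⟦lam, β, k⟧.V i) := by
  show ContDiff ℝ n fun r : ℝ => β * r ^ 4 / 4
  fun_prop

/-- `U_i'(q) = [i<k] lam q³` for the limit cell chain. [folklore] -/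
theorem prefixLimit_deriv_U (i : ℕ) (q : ℝ) :
    deriv (P₀⟦lam, β, k⟧.U i) q =
      (if i < k then lam else 0) * q ^ 3 := by
  show deriv (fun q : ℝ => (if i < k then lam else 0) * q ^ 4 / 4) q = _
  have h : HasDerivAt (fun q : ℝ => (if i < k then lam else 0) * q ^ 4 / 4)
      ((if i < k then lam else 0) * (↑(4 : ℕ) * q ^ (4 - 1)) / 4) q :=
    ((hasDerivAt_pow 4 q).const_mul _).div_const 4
  rw [h.deriv]; push_cast; ring

/-- `V_i'(r) = β r³` for the limit cell chain. [folklore] -/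
theorem prefixLimit_deriv_V (i : ℕ) (r : ℝ) :
    deriv (P₀⟦lam, β, k⟧.V i) r = β * r ^ 3 := by
  show deriv (fun r : ℝ => β * r ^ 4 / 4) r = _
  have h : HasDerivAt (fun r : ℝ => β * r ^ 4 / 4) (β * (↑(4 : ℕ) * r ^ (4 - 1)) / 4) r :=
    ((hasDerivAt_pow 4 r).const_mul β).div_const 4
  rw [h.deriv]; push_cast; ring

/-- **The sitewise force of the limit cell chain** in closed form:
`∂ᵢΦ₀(q) = [i<k] lam qᵢ³ + [0<i] β(qᵢ - qᵢ₋₁)³ - [i+1 ≤ k] β(qᵢ₊₁ - qᵢ)³`. [folklore] -/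
theorem prefixLimit_dPotential_eq (i : Fin (k + 1)) (q : Fin (k + 1) → ℝ) :
    P₀⟦lam, β, k⟧.dPotential (k + 1) i q =
      (if i.val < k then lam else 0) * q i ^ 3 +
        (if h : 0 < i.val then β * (q i - q ⟨i.val - 1, by omega⟩) ^ 3 else 0) -
        (if h : i.val + 1 < k + 1 then β * (q ⟨i.val + 1, h⟩ - q i) ^ 3 else 0) := by
  rw [SiteChain.dPotential_eq_closed, prefixLimit_deriv_U]
  congr 1
  · congr 1
    split_ifs with h
    · rw [prefixLimit_deriv_V]
    · rfl
  · split_ifs with h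
    · rw [prefixLimit_deriv_V]
    · rfl

/-- **The drift of the limit cell chain** (`γ = 0`: the Hamiltonian vector field `(p, -∇Φ₀)`).
[folklore] -/
theorem prefixLimit_langevinDrift_eq (u : PhaseSpace (k + 1)) :
    SiteChain.langevinDrift
        P₀⟦lam, β, k⟧ (k + 1) u =
      (u.2, fun i => -(P₀⟦lam, β, k⟧.dPotential (k + 1) i u.1)) := by
  have hU : ∀ i, Differentiable ℝ (P₀⟦lam, β, k⟧.U i) := fun i =>
    (prefixLimit_contDiff_U lam β k i (n := 1)).differentiable one_ne_zero
  have hV : ∀ i, Differentiable ℝ (P₀⟦lam, β, k⟧.V i) := fun i =>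
    (prefixLimit_contDiff_V lam β k i (n := 1)).differentiable one_ne_zero
  rw [SiteChain.langevinDrift_eq _ hU hV]
  ext i
  · rfl
  · simp

/-- **The energy of the limit cell chain**:
`Ĥ₀(q̃, p̃) = ∑ᵢ (p̃ᵢ²/2 + [i<k] lam q̃ᵢ⁴/4) + ∑_{j=i+1} β (q̃ⱼ - q̃ᵢ)⁴/4`. [folklore] -/
theorem prefixLimit_hamiltonian_eq (u : PhaseSpace (k + 1)) :
    P₀⟦lam, β, k⟧.hamiltonian (k + 1) u =
      (∑ i : Fin (k + 1), (u.2 i ^ 2 / 2 + (if i.val < k then lam else 0) * u.1 i ^ 4 / 4)) +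
        ∑ i : Fin (k + 1), ∑ j : Fin (k + 1),
          if j.val = i.val + 1 then β * (u.1 j - u.1 i) ^ 4 / 4 else 0 := rfl

variable {lam β}

/-- The potentials of the limit cell chain are nonnegative (`lam, β ≥ 0`). [folklore] -/
theorem prefixLimit_U_nonneg (hl : 0 ≤ lam) (j : ℕ) (q : ℝ) :
    0 ≤ P₀⟦lam, β, k⟧.U j q := by
  show 0 ≤ (if j < k then lam else 0) * q ^ 4 / 4
  have : 0 ≤ (if j < k then lam else 0 : ℝ) := by split_ifs <;> linarith
  positivity

/-- The bonds of the limit cell chain are nonnegative (`β ≥ 0`). [folklore] -/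
theorem prefixLimit_V_nonneg (hβ : 0 ≤ β) (j : ℕ) (r : ℝ) :
    0 ≤ P₀⟦lam, β, k⟧.V j r := by
  show 0 ≤ β * r ^ 4 / 4; positivity

/-- Each momentum and each pinned position of the limit cell chain is controlled by the energy:
`p̃ᵢ²/2 + [i<k] lam q̃ᵢ⁴/4 ≤ Ĥ₀` (`lam, β ≥ 0`). [folklore] -/
theorem prefixLimit_site_le_hamiltonian (hl : 0 ≤ lam) (hβ : 0 ≤ β) (u : PhaseSpace (k + 1))
    (i : Fin (k + 1)) :
    u.2 i ^ 2 / 2 + (if i.val < k then lam else 0) * u.1 i ^ 4 / 4 ≤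
      P₀⟦lam, β, k⟧.hamiltonian (k + 1) u :=
  SiteChain.site_le_hamiltonian _ (prefixLimit_U_nonneg (k := k) hl) (prefixLimit_V_nonneg (k := k) hβ) (k + 1) u i

/-- Each bond of the limit cell chain is controlled by the energy: `β(q̃ⱼ - q̃ᵢ)⁴/4 ≤ Ĥ₀` for
`j = i + 1` (`lam, β ≥ 0`). [folklore] -/
theorem prefixLimit_bond_le_hamiltonian (hl : 0 ≤ lam) (hβ : 0 ≤ β) (u : PhaseSpace (k + 1))
    {i j : Fin (k + 1)} (hj : j.val = i.val + 1) :
    β * (u.1 j - u.1 i) ^ 4 / 4 ≤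
      P₀⟦lam, β, k⟧.hamiltonian (k + 1) u :=
  SiteChain.bond_le_hamiltonian _ (prefixLimit_U_nonneg (k := k) hl) (prefixLimit_V_nonneg (k := k) hβ) (k + 1) u hj

/-- **Positions of the limit cell chain are controlled by the energy** (`lam > 0` pins the sites
`< k`, the bond `β > 0` ties the interface site `k` to `k - 1`; `k ≥ 1`): on `{Ĥ₀ ≤ h₀}`,
`|q̃ᵢ| ≤ 2 (max 1 (4h₀/lam) + max 1 (4h₀/β))`. [folklore] -/
theorem prefixLimit_abs_fst_le (hl : 0 < lam) (hβ : 0 < β) (hk : 0 < k) {h₀ : ℝ}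
    (u : PhaseSpace (k + 1))
    (hu : P₀⟦lam, β, k⟧.hamiltonian (k + 1) u ≤ h₀)
    (i : Fin (k + 1)) :
    |u.1 i| ≤ 2 * (max 1 (4 * h₀ / lam) + max 1 (4 * h₀ / β)) := by
  have hm1 : 1 ≤ max 1 (4 * h₀ / lam) := le_max_left _ _
  have hm2 : 1 ≤ max 1 (4 * h₀ / β) := le_max_left _ _
  -- pinned sites
  have hpin : ∀ j : Fin (k + 1), j.val < k → |u.1 j| ≤ max 1 (4 * h₀ / lam) := by
    intro j hj
    have h1 := prefixLimit_site_le_hamiltonian k hl.le hβ.le u j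
    rw [if_pos hj] at h1
    have h2 : lam * u.1 j ^ 4 / 4 ≤ h₀ := by nlinarith [sq_nonneg (u.2 j)]
    have h3 : u.1 j ^ 4 ≤ 4 * h₀ / lam := by
      rw [le_div_iff₀ hl]; nlinarith
    exact abs_le_max_one_of_pow_four_le h3
  by_cases hi : i.val < k
  · have := hpin i hi
    linarith [abs_nonneg (u.1 i)]
  · -- the interface site `i = k`, tied to `k - 1`
    have hik : i.val = k := by omega
    obtain ⟨j, hjdef⟩ : ∃ j : Fin (k + 1), j = ⟨k - 1, by omega⟩ := ⟨_, rfl⟩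
    have hjv : j.val = k - 1 := by rw [hjdef]
    have hj : j.val < k := by omega
    have hji : i.val = j.val + 1 := by omega
    have hb := prefixLimit_bond_le_hamiltonian k hl.le hβ.le u hji
    have h2 : (u.1 i - u.1 j) ^ 4 ≤ 4 * h₀ / β := by
      rw [le_div_iff₀ hβ]; nlinarith
    have h3 : |u.1 i - u.1 j| ≤ max 1 (4 * h₀ / β) := abs_le_max_one_of_pow_four_le h2
    have h4 := hpin j hj
    calc |u.1 i| = |(u.1 i - u.1 j) + u.1 j| := by ring_nf
      _ ≤ |u.1 i - u.1 j| + |u.1 j| := abs_add_le _ _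
      _ ≤ max 1 (4 * h₀ / β) + max 1 (4 * h₀ / lam) := add_le_add h3 h4
      _ ≤ 2 * (max 1 (4 * h₀ / lam) + max 1 (4 * h₀ / β)) := by linarith

/-- Momenta of the limit cell chain on `{Ĥ₀ ≤ h₀}`: `|p̃ᵢ| ≤ max 1 (2h₀)`. [folklore] -/
theorem prefixLimit_abs_snd_le (hl : 0 ≤ lam) (hβ : 0 ≤ β) {h₀ : ℝ} (u : PhaseSpace (k + 1))
    (hu : P₀⟦lam, β, k⟧.hamiltonian (k + 1) u ≤ h₀)
    (i : Fin (k + 1)) : |u.2 i| ≤ max 1 (2 * h₀) := by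
  have h1 := prefixLimit_site_le_hamiltonian k hl hβ u i
  have h0 : 0 ≤ (if i.val < k then lam else 0) * u.1 i ^ 4 / 4 := by
    have : 0 ≤ (if i.val < k then lam else 0 : ℝ) := by split_ifs <;> linarith
    positivity
  have h2 : u.2 i ^ 2 ≤ 2 * h₀ := by linarith
  rcases le_or_gt |u.2 i| 1 with h3 | h3
  · exact h3.trans (le_max_left _ _)
  · refine le_max_of_le_right ?_
    have h4 : |u.2 i| ^ 2 = u.2 i ^ 2 := sq_abs _
    nlinarith [abs_nonneg (u.2 i)]

/-! ### The region and the Lipschitz constant of the limit drift -/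

/-- The region `{|p̃ᵢ| ≤ Cp, |q̃ᵢ| ≤ Cq}` of the rescaled cell-block phase space on which both the
projected rescaled path and the limit solution live. [folklore] -/
def prefixRungRegion (Cp Cq : ℝ) : Set (PhaseSpace (k + 1)) :=
  {u | (∀ i, |u.2 i| ≤ Cp) ∧ ∀ i, |u.1 i| ≤ Cq}

/-- A cubic term with a nonnegative amplitude is Lipschitz on bounded arguments:
`|a r³ - a r'³| ≤ 3 a B² D` for `|r|, |r'| ≤ B`, `|r - r'| ≤ D`. [folklore] -/
theorem abs_mul_cube_sub_le {a r r' B D : ℝ} (ha : 0 ≤ a) (hr : |r| ≤ B) (hr' : |r'| ≤ B)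
    (hD : |r - r'| ≤ D) : |a * r ^ 3 - a * r' ^ 3| ≤ 3 * a * B ^ 2 * D := by
  rw [← mul_sub, abs_mul, abs_of_nonneg ha]
  have hD0 : 0 ≤ D := (abs_nonneg _).trans hD
  have h1 := abs_pow_three_sub_pow_three_le r r'
  have h2 : r ^ 2 + r' ^ 2 ≤ 2 * B ^ 2 := by
    have e1 := sq_abs r; have e2 := sq_abs r'
    nlinarith [abs_nonneg r, abs_nonneg r']
  calc a * |r ^ 3 - r' ^ 3| ≤ a * (3 / 2 * (r ^ 2 + r' ^ 2) * |r - r'|) :=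
        mul_le_mul_of_nonneg_left h1 ha
    _ ≤ a * (3 / 2 * (2 * B ^ 2) * D) := by
        refine mul_le_mul_of_nonneg_left ?_ ha
        exact mul_le_mul (by nlinarith) hD (abs_nonneg _) (by positivity)
    _ = 3 * a * B ^ 2 * D := by ring

/-- **The limit drift is Lipschitz on the region** (sup norm), with constant
`L = 1 + 3 lam Cq² + 48 β Cq²` (`lam, β ≥ 0`). [folklore] -/
theorem lipschitzOnWith_prefixLimit_drift (hl : 0 ≤ lam) (hβ : 0 ≤ β) (Cp Cq : ℝ) :
    LipschitzOnWith (Real.toNNReal (1 + 3 * lam * Cq ^ 2 + 48 * β * Cq ^ 2))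
      (SiteChain.langevinDrift
        P₀⟦lam, β, k⟧ (k + 1))
      (prefixRungRegion k Cp Cq) := by
  set L := 1 + 3 * lam * Cq ^ 2 + 48 * β * Cq ^ 2 with hL
  have hL0 : 0 ≤ L := by positivity
  have hF0 : 0 ≤ 3 * lam * Cq ^ 2 + 48 * β * Cq ^ 2 := by positivity
  refine LipschitzOnWith.of_dist_le_mul fun z hz z' hz' => ?_
  rw [Real.coe_toNNReal _ hL0, dist_eq_norm, dist_eq_norm]
  have hzz : ∀ i, |z.1 i - z'.1 i| ≤ ‖z - z'‖ := fun i => by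
    rw [← Real.norm_eq_abs]
    exact (norm_le_pi_norm (z - z').1 i).trans (norm_fst_le _)
  have hpp : ∀ i, |z.2 i - z'.2 i| ≤ ‖z - z'‖ := fun i => by
    rw [← Real.norm_eq_abs]
    exact (norm_le_pi_norm (z - z').2 i).trans (norm_snd_le _)
  have hn0 : 0 ≤ ‖z - z'‖ := norm_nonneg _
  -- the force components
  have hF : ∀ i, |P₀⟦lam, β, k⟧.dPotential (k + 1) i z.1 -
      P₀⟦lam, β, k⟧.dPotential (k + 1) i z'.1| ≤
      (3 * lam * Cq ^ 2 + 48 * β * Cq ^ 2) * ‖z - z'‖ := by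
    intro i
    rw [prefixLimit_dPotential_eq, prefixLimit_dPotential_eq]
    -- pinning
    have ha : 0 ≤ (if i.val < k then lam else 0 : ℝ) := by split_ifs <;> linarith
    have ha' : (if i.val < k then lam else 0 : ℝ) ≤ lam := by split_ifs <;> linarith
    have h1 : |(if i.val < k then lam else 0) * z.1 i ^ 3 - (if i.val < k then lam else 0) * z'.1 i ^ 3| ≤
        3 * lam * Cq ^ 2 * ‖z - z'‖ :=
      (abs_mul_cube_sub_le ha (hz.2 i) (hz'.2 i) (hzz i)).trans (by gcongr)
    -- bonds: stretches are `≤ 2Cq`, differences of stretches `≤ 2‖z - z'‖`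
    have hst : ∀ (w : PhaseSpace (k + 1)), w ∈ prefixRungRegion k Cp Cq → ∀ a b : Fin (k + 1),
        |w.1 a - w.1 b| ≤ 2 * Cq := fun w hw a b =>
      (abs_sub _ _).trans (by linarith [hw.2 a, hw.2 b])
    have hdst : ∀ a b : Fin (k + 1), |(z.1 a - z.1 b) - (z'.1 a - z'.1 b)| ≤ 2 * ‖z - z'‖ := by
      intro a b
      calc |(z.1 a - z.1 b) - (z'.1 a - z'.1 b)| = |(z.1 a - z'.1 a) - (z.1 b - z'.1 b)| := by ring_nf
        _ ≤ |z.1 a - z'.1 a| + |z.1 b - z'.1 b| := abs_sub _ _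
        _ ≤ 2 * ‖z - z'‖ := by linarith [hzz a, hzz b]
    have hb : ∀ a b : Fin (k + 1), |β * (z.1 a - z.1 b) ^ 3 - β * (z'.1 a - z'.1 b) ^ 3| ≤
        24 * β * Cq ^ 2 * ‖z - z'‖ := fun a b =>
      (abs_mul_cube_sub_le hβ (hst z hz a b) (hst z' hz' a b) (hdst a b)).trans (le_of_eq (by ring))
    have h2 : |(if h : 0 < i.val then β * (z.1 i - z.1 ⟨i.val - 1, by omega⟩) ^ 3 else 0) -
        (if h : 0 < i.val then β * (z'.1 i - z'.1 ⟨i.val - 1, by omega⟩) ^ 3 else 0)| ≤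
        24 * β * Cq ^ 2 * ‖z - z'‖ := by
      split_ifs with h
      · exact hb _ _
      · simp only [sub_self, abs_zero]; positivity
    have h3 : |(if h : i.val + 1 < k + 1 then β * (z.1 ⟨i.val + 1, h⟩ - z.1 i) ^ 3 else 0) -
        (if h : i.val + 1 < k + 1 then β * (z'.1 ⟨i.val + 1, h⟩ - z'.1 i) ^ 3 else 0)| ≤
        24 * β * Cq ^ 2 * ‖z - z'‖ := by
      split_ifs with h
      · exact hb _ _
      · simp only [sub_self, abs_zero]; positivity
    have key : ∀ (a a' b b' c c' : ℝ), |(a + b - c) - (a' + b' - c')| ≤ |a - a'| + |b - b'| + |c - c'| := by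
      intro a a' b b' c c'
      calc |(a + b - c) - (a' + b' - c')| = |(a - a') + (b - b') - (c - c')| := by ring_nf
        _ ≤ |(a - a') + (b - b')| + |c - c'| := abs_sub _ _
        _ ≤ |a - a'| + |b - b'| + |c - c'| := by linarith [abs_add_le (a - a') (b - b')]
    refine (key _ _ _ _ _ _).trans ?_
    calc _ ≤ 3 * lam * Cq ^ 2 * ‖z - z'‖ + 24 * β * Cq ^ 2 * ‖z - z'‖ + 24 * β * Cq ^ 2 * ‖z - z'‖ :=
          add_le_add (add_le_add h1 h2) h3
      _ = (3 * lam * Cq ^ 2 + 48 * β * Cq ^ 2) * ‖z - z'‖ := by ring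
  -- assemble in the sup norm
  rw [prefixLimit_langevinDrift_eq, prefixLimit_langevinDrift_eq]
  refine (Prod.norm_def _).le.trans (max_le ?_ ?_)
  · -- position component: `p - p'`
    refine (pi_norm_le_iff_of_nonneg (by positivity)).2 fun i => ?_
    simp only [Prod.fst_sub, Pi.sub_apply, Real.norm_eq_abs]
    calc |z.2 i - z'.2 i| ≤ ‖z - z'‖ := hpp i
      _ = 1 * ‖z - z'‖ := (one_mul _).symm
      _ ≤ L * ‖z - z'‖ := by gcongr; rw [hL]; linarith
  · refine (pi_norm_le_iff_of_nonneg (by positivity)).2 fun i => ?_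
    simp only [Prod.snd_sub, Pi.sub_apply, Real.norm_eq_abs]
    rw [show ∀ a b : ℝ, -a - -b = -(a - b) from fun a b => by ring, abs_neg]
    calc _ ≤ (3 * lam * Cq ^ 2 + 48 * β * Cq ^ 2) * ‖z - z'‖ := hF i
      _ ≤ L * ‖z - z'‖ := by gcongr; rw [hL]; linarith

end Limit

end Literature.MathematicalPhysics.KineticTheory.HeatConduction
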